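import Literature.AlgebraicGeometry.Resolution.RsopMonomialIdeals
import Literature.AlgebraicGeometry.Resolution.RegularLocalRingsQuotient
import Mathlib.RingTheory.Valuation.ValuationSubring
import Mathlib.Algebra.CharP.Lemmas
import HarnessLib

/-!
# Crux `Steer` (stmt-16345), r9 residual R1 `stub_core4LowMult` at `p = 2`: every stage steps or is of order one

OURS (campaign `res-hironaka`, rung L, slot W4.1, chain W4.1; replaces the role of no printed item; NOT a
statement of the manuscript under review). The registered frontier stub `stub_core4LowMult` (the greedy
torsor run STALLS at a stage that is neither steppable nor of order one: cleaned order `ν ∈ [2, p-1]`) is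
EMPTY at `p = 2`. This file PROVES the characteristic-2 core of that claim, hypothesis-explicit and
Theses-free (CRUX-PLAN-Steer v2 §E, side item `core4LowMult_two` of seat stub-2):

* `exists_isExcParam` — a Noetherian local subring `S ⊆ K` whose maximal ideal is the centre of `O` and
  is non-zero has an EXCEPTIONAL PARAMETER (an element of the centre of maximal value; r9 `IsExcParam`,
  unfolded): a generator of `𝔪_S` of largest value.
* `isRsopPart_one_of_not_mem_sq` — in a regular local ring an element of `𝔪 ∖ 𝔪²` is a one-element part
  of a regular system of parameters (Matsumura Thm. 14.2, via the tree's `quotient_span_singleton`).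
* `canStep_or_orderOneAt_two` — CHARACTERISTIC 2: for a regular local `S` dominated by `O` with perfect
  residue field (every element is a square mod `𝔪_S`), an exceptional parameter `x` with the quadratic-
  transform division property `y ∈ 𝔪_S ⇒ y / x ∈ S₁`, and `s ^ 2 ∈ S`: either the run CAN STEP
  (`s = x s' + g` with `s' ^ 2 ∈ S₁` — r9 `CanStep`, unfolded) or the stage is of ORDER ONE
  (`s ^ 2 - g ^ 2` a regular parameter — r9 `OrderOneAt`, unfolded). Key identity: `(s - g)² = s² - g²`.

The by-name corollary for the registered `Sig.stub_core4LowMult` at `p = 2` follows once the chain's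
Q1 (`div_mem_of_isQuadraticTransformAlong`, stub-4) and the perfectness of the residue fields of the
quadratic sequence (`ZeroDim` + perfect `k`; lead-1's leaf) land. [folklore]
-/

noncomputable section

-- layout-mandated namespace `Summit.<Summit>.<Problem>.…` with Summit = Problem (single-conjunct summit)
set_option linter.dupNamespace false

open IsLocalRing
open Literature.AlgebraicGeometry.Resolution

namespace Summit.ResolutionOfSingularities.ResolutionOfSingularities.Theorems.SwitchingDichotomy.LowMult

variable {K : Type} [Field K]

/-! ### Exceptional parameters exist -/

/-- **Exceptional parameters exist.** Let `S ⊆ K` be a Noetherian local subring whose maximal ideal is the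
centre of `O` (`a ∈ 𝔪_S ↔ v a < 1`, i.e. `S` is dominated by `O`) and is non-zero. Then some `x ∈ S`,
`x ≠ 0`, `v x < 1`, has maximal value among the elements of the centre: a generator of `𝔪_S` of largest
value (ultrametric inequality). This is r9's `IsExcParam O S x`, unfolded. [folklore] -/
theorem exists_isExcParam (O : ValuationSubring K) (S : Subring K) [IsLocalRing S] [IsNoetherianRing S]
    (hSO : S ≤ O.toSubring) (hdom : ∀ a : S, a ∈ maximalIdeal S ↔ O.valuation (a : K) < 1)
    (hne : maximalIdeal S ≠ ⊥) :
    ∃ x : K, x ∈ S ∧ x ≠ 0 ∧ O.valuation x < 1 ∧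
      ∀ y ∈ S, O.valuation y < 1 → O.valuation y ≤ O.valuation x := by
  classical
  obtain ⟨G, hG⟩ := (IsNoetherian.noetherian (maximalIdeal S) : (maximalIdeal S).FG)
  -- the non-zero generators
  set G' := G.filter (fun g => g ≠ 0) with hG'
  have hG'ne : G'.Nonempty := by
    by_contra h
    rw [Finset.not_nonempty_iff_eq_empty] at h
    apply hne
    rw [← hG, Submodule.span_eq_bot]
    intro g hg
    by_contra hg0
    have : g ∈ G' := Finset.mem_filter.mpr ⟨hg, hg0⟩
    rw [h] at this
    exact Finset.notMem_empty g this
  obtain ⟨x, hxG', hxmax⟩ := G'.exists_max_image (fun g : S => O.valuation (g : K)) hG'ne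
  obtain ⟨hxG, hx0⟩ := Finset.mem_filter.mp hxG'
  have hxm : x ∈ maximalIdeal S := by rw [← hG]; exact Submodule.subset_span hxG
  refine ⟨x, x.2, fun h => hx0 (Subtype.ext h), (hdom x).mp hxm, fun y hyS hy => ?_⟩
  have hym : (⟨y, hyS⟩ : S) ∈ maximalIdeal S := (hdom ⟨y, hyS⟩).mpr hy
  rw [← hG] at hym
  -- ultrametric induction over the span
  refine Submodule.span_induction (p := fun (z : S) _ => O.valuation (z : K) ≤ O.valuation (x : K))
    ?_ ?_ ?_ ?_ hym
  · intro g hg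
    by_cases hg0 : g = 0
    · rw [hg0, ZeroMemClass.coe_zero, map_zero]; exact zero_le
    · exact hxmax g (Finset.mem_filter.mpr ⟨hg, hg0⟩)
  · rw [ZeroMemClass.coe_zero, map_zero]; exact zero_le
  · intro a b _ _ ha hb
    rw [Subring.coe_add]
    exact (Valuation.map_add_le_max' O.valuation _ _).trans (max_le ha hb)
  · intro a b _ hb
    rw [smul_eq_mul, Subring.coe_mul, map_mul]
    calc O.valuation (a : K) * O.valuation (b : K) ≤ 1 * O.valuation (x : K) :=
          mul_le_mul' ((O.valuation_le_one_iff _).mpr (hSO a.2)) hb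
      _ = O.valuation (x : K) := one_mul _

/-! ### One-element parts of regular systems of parameters -/

/-- In a regular local ring, an element of `𝔪 ∖ 𝔪²` is a one-element part of a regular system of
parameters (Matsumura Thm. 14.2: `R/(h)` is regular of dimension `dim R - 1`). [folklore] -/
theorem isRsopPart_one_of_not_mem_sq {R : Type} [CommRing R] [IsRegularLocalRing R] {h : R}
    (hh : h ∈ maximalIdeal R) (hh2 : h ∉ maximalIdeal R ^ 2) : IsRsopPart (fun _ : Fin 1 => h) := by
  obtain ⟨hq, hdim⟩ := IsRegularLocalRing.quotient_span_singleton hh hh2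
  have hr : Set.range (fun _ : Fin 1 => h) = {h} := Set.range_const
  have hq' : IsRegularLocalRing (R ⧸ Ideal.span (Set.range fun _ : Fin 1 => h)) := by rw [hr]; exact hq
  have hdim' : ringKrullDim (R ⧸ Ideal.span (Set.range fun _ : Fin 1 => h)) + (1 : ℕ) ≤ ringKrullDim R := by
    rw [hr, Nat.cast_one]
    exact hdim.le
  exact IsRsopPart.of_isRegularLocalRing_quotient (fun _ => hh) (hq := hq') hdim'

/-! ### Characteristic 2: every stage steps or is of order one -/

/-- **`p = 2`: the greedy torsor run never stalls at an intermediate order** (core of `core4LowMult_two`).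
Let `S ⊆ O` be a regular local subring with `𝔪_S` the centre of `O`, in characteristic `2`, whose residue
field is perfect in the form «every `f ∈ S` is a square modulo `𝔪_S`»; let `x` be an exceptional parameter
with the division property `y ∈ 𝔪_S ⇒ y / x ∈ S₁` (the quadratic transform), and `s ^ 2 ∈ S`. Then
EITHER `s = x · s' + g` with `g ∈ S`, `s' ^ 2 ∈ S₁` (r9 `CanStep`, with `x` as the exceptional parameter),
OR `s ^ 2 - g ^ 2` is a one-element part of a regular system of parameters of `S` for some `g ∈ S`
(r9 `OrderOneAt`). Proof: `s² ≡ g₀² (mod 𝔪)`; `h := s² - g₀² = (s - g₀)²` (characteristic 2); if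
`h ∈ 𝔪²` then `((s - g₀)/x)² = h/x² ∈ S₁`, else `h ∈ 𝔪 ∖ 𝔪²` is a regular parameter. [folklore] -/
theorem canStep_or_orderOneAt_two [CharP K 2] (O : ValuationSubring K) (S S₁ : Subring K)
    [IsRegularLocalRing S] (hdom : ∀ a : S, a ∈ maximalIdeal S ↔ O.valuation (a : K) < 1)
    (hperf : ∀ f : S, ∃ g : S, f - g ^ 2 ∈ maximalIdeal S)
    (x : K) (hx : x ∈ S ∧ x ≠ 0 ∧ O.valuation x < 1 ∧
      ∀ y ∈ S, O.valuation y < 1 → O.valuation y ≤ O.valuation x)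
    (hdiv : ∀ y ∈ S, O.valuation y < 1 → y / x ∈ S₁)
    (s : K) (hs : s ^ 2 ∈ S) :
    (∃ s' : K, (∃ x' g : K, (x' ∈ S ∧ x' ≠ 0 ∧ O.valuation x' < 1 ∧
        ∀ y ∈ S, O.valuation y < 1 → O.valuation y ≤ O.valuation x') ∧ g ∈ S ∧ s = x' * s' + g) ∧
        s' ^ 2 ∈ S₁) ∨
    (∃ g ∈ S, ∃ (_ : IsLocalRing S) (z : Fin 1 → S), IsRsopPart z ∧ ((z 0 : S) : K) = s ^ 2 - g ^ 2) := by
  obtain ⟨g₀, hg₀⟩ := hperf ⟨s ^ 2, hs⟩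
  set h : S := ⟨s ^ 2, hs⟩ - g₀ ^ 2 with hh
  have hhK : (h : K) = s ^ 2 - (g₀ : K) ^ 2 := by
    rw [hh, AddSubgroupClass.coe_sub, SubmonoidClass.coe_pow]
  -- characteristic 2: `(s - g₀)² = s² - g₀²`
  have hsq : (s - (g₀ : K)) ^ 2 = (h : K) := by
    haveI : Fact (Nat.Prime 2) := ⟨Nat.prime_two⟩
    rw [hhK, sub_pow_char s (g₀ : K)]
  by_cases h2 : h ∈ maximalIdeal S ^ 2
  · -- the run steps: `s' = (s - g₀) / x`
    left
    refine ⟨(s - g₀) / x, ⟨x, g₀, hx, g₀.2, ?_⟩, ?_⟩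
    · rw [mul_div_cancel₀ _ hx.2.1, sub_add_cancel]
    · rw [div_pow, hsq, pow_two]
      -- `h ∈ 𝔪² ⇒ h / x² ∈ S₁`
      have key : ∀ y ∈ maximalIdeal S ^ 2, ((y : S) : K) / (x * x) ∈ S₁ := by
        intro y hy
        rw [pow_two] at hy
        refine Submodule.mul_induction_on hy (fun a ha b hb => ?_) (fun a b ha hb => ?_)
        · rw [Subring.coe_mul, mul_div_mul_comm]
          exact S₁.mul_mem (hdiv a a.2 ((hdom a).mp ha)) (hdiv b b.2 ((hdom b).mp hb))
        · rw [Subring.coe_add, add_div]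
          exact S₁.add_mem ha hb
      exact key h h2
  · -- order one: `h ∈ 𝔪 ∖ 𝔪²` is a regular parameter
    right
    exact ⟨g₀, g₀.2, inferInstance, fun _ => h, isRsopPart_one_of_not_mem_sq hg₀ h2, hhK⟩

end Summit.ResolutionOfSingularities.ResolutionOfSingularities.Theorems.SwitchingDichotomy.LowMult

end
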